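/-
Copyright (c) 2026 the pub-hodgecm-mathlib formalisation cell (harness21).  Prover seat hodgecm-mathlib-K2E1-p10 (g6), Track B ∕ K2-LIT, h413 =
`stmt-HodgeConjecture-24833`, route `HCCMUnconditional`; R90-TF S8 «ContSpec-n½», (M) socket road, RES-INT line 7 (7d)-prep: the letter (ONE-N) of
ED. 3 (`res_middleResidue_isPiN_of_constituent`) AT ONE NON-SPLIT PLACE from the DICTIONARY LETTERS, through ★ (7b) p865019.
-/
import Summits.HodgeConjecture.HodgeConjecture.Theorems.R90S8ResMidConstituentOfIntertwinersU3        -- ★ p865019 (this seat) (7b): `exists_isConstituentOf_equiv_quotientRep_of_meets_iSup_range`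
import Summits.HodgeConjecture.HodgeConjecture.Theorems.R90S8ResMiddleResidueIsPiNOfLettersV2U3     -- ★ p864766 (this seat) ED. 2: the S8 vocabulary of the pin (QUOT-N) (`cmPrincipalSeries`, `cmDatumLocalCongr`, `localPiEquiv`, `Gqs`)
import Literature.NumberTheory.Automorphic.IrreducibleClassesComap                                  -- ★ `IrrClass.comap_comap_symm`, `IrrClass.isConstituentOf_comp_iff_comap_symm`
import Literature.NumberTheory.Automorphic.ParabolicInductionAdmissibleProofs                       -- ★ `Representation.IsSmooth.comp`
import HarnessLib

/-!
# R90 · S8 «ContSpec-n½» — `R90S8ResMidOneConstituentOfDictionaryU3`: the letter (ONE-N) of (M) :299 ED. 3 AT ONE NON-SPLIT PLACE, from the DICTIONARY letters — an ambient smooth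
# `G_v`-module `ρ_v ⊇ P` whose constituents are constituents of `P′|_{G_v}` (D1), intertwining maps `Φ_i : i_G(χ_{ξ,v}) → ρ_v ∘ e` killing `K` (D2 = section dictionary ∘ `Res`, FACT-N,
# ORIENT), and «`P` meets the span of their images» (D3 = (7d)) [Rogawski1990 §12.2–§13.1; BernsteinZelevinsky1976 §2.1; MoeglinWaldspurger1995 IV.1.11]

Cell `pub/hodgecm-mathlib`, crux H413 = `stmt-HodgeConjecture-24833` (lane `--kind proof --supports stmt-HodgeConjecture-24833 --as helper`), route of record
`HCCMUnconditional`; programme R90-TF, section S8, the (M) socket road, RES-INT line 7.  THEOREMS ONLY (no `def`, no `instance`, no `notation`, no `sorry`).  CLOSES NO SOCKET.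

THE STEP.  ED. 3 (`res_middleResidue_isPiN_of_constituent`, GREEN d213b9c718bcf3a7 ∕ 📤 p865082) closes (M) :299's ∃-body from `hLQ`, `hKO`, `hAF` and two letters; the non-split one is
(ONE-N): at each non-split `v`, along SOME frame `e = cmDatumLocalCongr L v T ha h : U(Φ₃)(L⁺_v) ≃ₜ* U(J₃)(L⁺_v)`, SOME constituent class `c` of `P′.finRep.smoothPart ∘ inclPlace v` has
`comap e c = ⟦r⟧` with `r ≅ i_G(χ_{ξ,v}) ∕ N`.  This file produces EXACTLY that ∃-body at a given `(v, T, a, ha, h)` (§2 `oneN_at_of_dictionary`) from: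
* (D1) an ambient SMOOTH representation `ρ_v` of `G_v = U(J₃)(L⁺_v)` on `X : Type` with a subrepresentation `P` all of whose constituents are constituents of `P′.finRep.smoothPart ∘ inclPlace v`
  (read through `IrrClass.comap (localPiEquiv …)`) — in the application `X` = the smooth vectors of `L²` for the finite-adelic right translation, `P = P′^∞`;
* (D2) a subrepresentation `K ≤ i_G(χ_{ξ,v})` (★ `cmPrincipalSeries L 3 v (cmXiTorusChar …)`) with irreducible quotient (ORIENT ★ `KeysOrientation` (i),(iii): `K = K_v` the maximal proper one) and
  intertwining maps `Φ_i : i_G(χ_{ξ,v}) → ρ_v ∘ e` killing `K` — the section dictionary at finitely many away-from-`v` data composed with `Res` (★ LIN p864683, line 6 ★ p864700, ★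
  `residue_dict_equivariant` p864867), killing `K` by KER ★ p864667 ∘ FACT-N (★ `ker_local_le_ker_residue_dict` p864867 with `hfac` = ★ p864847's operator factorisation, `ker N_v = K` =
  J-S8-FN (a));
* (D3) `hmeet`: `P` contains a non-zero vector of `⨆ i, range Φ_i` — the (7d) letter «`P′ ∩ Res(V_τ) ≠ 0`» (hDISC ★ chain + `hW1` + Peter–Weyl).
THE MATHEMATICS (§1, generic).  For `e : G′ ≃ₜ* G`, a smooth `ρ` of `G` on `X : Type`, `P ≤ ρ`, `I` a representation of `G′` with `K ≤ I`, `I ∕ K` irreducible, `Φ_i : I → ρ ∘ e` killing `K` and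
`P` meeting the span: `P` is also a subrepresentation of the smooth `ρ ∘ e` (★ `IsSmooth.comp`), so ★ (7b) gives `r : SmoothIrrep G′` with `⟦r⟧` a constituent of `P ∘ e` and `r ≅ I ∕ K`;
`c := comap e⁻¹ ⟦r⟧` is then a constituent of `P` (★ `isConstituentOf_comp_iff_comap_symm`) with `comap e c = ⟦r⟧` (★ `comap_comap_symm`).
* §1 `exists_isConstituentOf_comap_eq_mk_equiv_quotientRep` (any `e : G′ ≃ₜ* G`).
* §2 **`oneN_at_of_dictionary`** — (ONE-N)'s body at `(v, T, a, ha, h)` in ★ p864766's bytes, from (D1)–(D3).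
HONEST LABEL: HC_CM is proved only modulo the 7 printed citations (2 remaining named inputs: hLiu418 = `stmt-HodgeConjecture-24832`, h413 = `stmt-HodgeConjecture-24833`) until
rung 0 closes; hypothesis-first on (D1)–(D3), pays no socket; count-neutral.

## References
* [Rogawski1990] J. D. Rogawski, *Automorphic Representations of Unitary Groups in Three Variables*, Ann. of Math. Stud. 123 (1990), §12.2 pp. 173–174; §13.1 p. 199.
* [BernsteinZelevinsky1976] I. N. Bernstein, A. V. Zelevinsky, *Representations of the group GL(n,F) where F is a non-archimedean local field*, Russian Math. Surveys 31:3 (1976), §2.1.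
* [MoeglinWaldspurger1995] C. Mœglin, J.-L. Waldspurger, *Spectral Decomposition and Eisenstein Series* (1995), IV.1.11, V.3.13.
-/

set_option autoImplicit false
-- the mandated namespace repeats the single-problem summit's segment (`HodgeConjecture.HodgeConjecture`)
set_option linter.dupNamespace false

noncomputable section

open MeasureTheory NumberField IsDedekindDomain
open scoped Matrix MatrixGroups
open Literature.NumberTheory.GaloisRepresentations Literature.NumberTheory.Automorphic.Arthur2013.Leaves.TECR
open Literature.NumberTheory.GaloisRepresentations.IsNonarchimedeanLocalField
open Literature.NumberTheory.Automorphic Literature.NumberTheory.Automorphic.UnitaryGroup Literature.NumberTheory.Rogawski1990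

namespace Summit.HodgeConjecture.HodgeConjecture.R90.S8

/-! ## §1 Generic: a constituent of `P` read through a group isomorphism `e : G′ ≃ₜ* G` -/

section Generic

universe u

variable {G G' : Type u} [Group G] [TopologicalSpace G] [Group G'] [TopologicalSpace G']
  {X : Type} [AddCommGroup X] [Module ℂ X] {ρ : Representation ℂ G X}
  {E : Type*} [AddCommGroup E] [Module ℂ E] {I : Representation ℂ G' E} {ι : Type*}

/-- **A CONSTITUENT OF `P` OF THE FORM `comap e c = ⟦r⟧`, `r ≅ I ∕ K`, from intertwining maps `I → ρ ∘ e` killing `K`.**  For `e : G′ ≃ₜ* G`, a smooth representation `ρ` of `G` on `X : Type`,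
a subrepresentation `P ≤ ρ`, a representation `I` of `G′` with `K ≤ I` and `I ∕ K` irreducible, intertwining maps `Φ_i : I → ρ ∘ e` with `K ≤ ker Φ_i`, and a non-zero vector of `P` in
`⨆ i, range Φ_i`: there is a constituent class `c` of `P` and an irreducible smooth `r` of `G′` with `comap e c = ⟦r⟧` and `r ≅ I ∕ K` (★ (7b) applied to the smooth `ρ ∘ e` and `P` viewed as
its subrepresentation; `c := comap e⁻¹ ⟦r⟧`). [cite: Rogawski1990, §12.2 pp. 173–174] [cite: BernsteinZelevinsky1976, §2.1] -/
theorem exists_isConstituentOf_comap_eq_mk_equiv_quotientRep (e : G' ≃ₜ* G) (hρ : ρ.IsSmooth) (P : Subrepresentation ρ)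
    (K : Subrepresentation I) (hK : K.quotientRep.IsIrreducible) (Φ : ι → I.IntertwiningMap (ρ.comp (e : G' →* G)))
    (hker : ∀ i, K ≤ (Φ i).ker) (hmeet : ∃ x ∈ P, x ≠ 0 ∧ x ∈ ⨆ i, LinearMap.range (Φ i).toLinearMap) :
    ∃ c : IrrClass G, c.IsConstituentOf P.toRepresentation ∧ ∃ r : SmoothIrrep G', IrrClass.comap e c = IrrClass.mk r ∧ Nonempty (r.ρ.Equiv K.quotientRep) := by
  -- `P` as a subrepresentation of the smooth `ρ ∘ e`
  set Pe : Subrepresentation (ρ.comp (e : G' →* G)) := ⟨P.toSubmodule, fun g' _ hv => P.apply_mem_toSubmodule (e g') hv⟩ with hPe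
  have hsm : Representation.IsSmooth (ρ.comp (e : G' →* G)) := hρ.comp (e : G' →* G) e.continuous
  have hmeet' : ∃ x ∈ Pe, x ≠ 0 ∧ x ∈ ⨆ i, LinearMap.range (Φ i).toLinearMap := hmeet
  obtain ⟨r, hr, er⟩ := exists_isConstituentOf_equiv_quotientRep_of_meets_iSup_range hsm K hK Φ hker Pe hmeet'
  -- `Pe.toRepresentation` IS `P.toRepresentation ∘ e`
  have hr' : (IrrClass.mk r).IsConstituentOf (P.toRepresentation.comp (e : G' →* G)) := hr
  refine ⟨IrrClass.comap e.symm (IrrClass.mk r), (IrrClass.isConstituentOf_comp_iff_comap_symm e P.toRepresentation _).1 hr', r,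
    IrrClass.comap_comap_symm e _, er⟩

end Generic

/-! ## §2 (ONE-N) at one non-split place from the dictionary letters (D1)–(D3) -/

section CM

variable (L : Type) [Field L] [NumberField L] [IsCMField L]

set_option synthInstance.maxHeartbeats 400000 in
set_option maxHeartbeats 4000000 in -- as ★ p864766 (the statement spells ★ `cmPrincipalSeries` + `Representation.quotient`)
/-- **(ONE-N) AT `(v, T, a, ha, h)` FROM THE DICTIONARY.**  At a place `v` of `L⁺` and a frame `e = cmDatumLocalCongr L v T ha h : U(Φ₃)(L⁺_v) ≃ₜ* U(J₃)(L⁺_v)`: given (D1) a smooth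
representation `ρ_v` of `U(J₃)(L⁺_v)` on `X : Type` and a subrepresentation `P` whose constituents are constituents of `P′.finRep.smoothPart ∘ inclPlace v` (through `IrrClass.comap
(localPiEquiv …)`), (D2) `K ≤ i_G(χ_{ξ,v})` with irreducible quotient and intertwining maps `Φ_i : i_G(χ_{ξ,v}) → ρ_v ∘ e` killing `K`, (D3) a non-zero vector of `P` in `⨆ i, range Φ_i` —
the ∃-body of ED. 3's letter `hONEn` at `(v, T, a, ha, h)` holds, in ★ p864766's bytes: `∃ c, (comap (localPiEquiv …) c).IsConstituentOf (P′…) ∧ ∃ r N, comap e c = ⟦r⟧ ∧ r ≅ i_G(χ_{ξ,v}) ∕ N`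
(with `N := K`).  READING: `Φ_i = Res ∘ (section dictionary at φᵛ_i)`, `hker` = KER ★ ∘ FACT-N ∘ ORIENT, `hmeet` = (7d) «`P′ ∩ Res(V_τ) ≠ 0`».
[cite: Rogawski1990, §12.2 pp. 173–174; §13.1 p. 199] [cite: MoeglinWaldspurger1995, IV.1.11] -/
theorem oneN_at_of_dictionary
    {μ : Measure (quasiSplit (↥(maximalRealSubfield L)) L (IsCMField.complexConj L) 3).automorphicQuotient}
    [(quasiSplit (↥(maximalRealSubfield L)) L (IsCMField.complexConj L) 3).IsAutomorphicMeasure μ]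
    (μω : HeckeCharacter L) (ξ : OneDimAutRepH L) (P' : DiscreteAutomorphicRep (quasiSplit (↥(maximalRealSubfield L)) L (IsCMField.complexConj L) 3) μ)
    (v : HeightOneSpectrum (𝓞 ↥(maximalRealSubfield L))) (T : GL (Fin 3) (LocalRing L v)) (a : LocalRing L v) (ha : IsUnit a)
    (h : formCongr (conjLocal L (IsCMField.complexConj L) v) T (((StdForm.antidiagonal 3).over L).map (algebraMap L (LocalRing L v))) =
      a • (Matrix.of fun i j : Fin 3 => if i.val + j.val + 1 = 3 then (1 : L) else 0).map (algebraMap L (LocalRing L v)))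
    -- (D1) the ambient smooth `G_v`-module and `P` inside it
    {X : Type} [AddCommGroup X] [Module ℂ X] (ρv : Representation ℂ ((quasiSplit (↥(maximalRealSubfield L)) L (IsCMField.complexConj L) 3).Local v) X)
    (hρv : ρv.IsSmooth) (P : Subrepresentation ρv)
    (hD1 : ∀ c : IrrClass ((quasiSplit (↥(maximalRealSubfield L)) L (IsCMField.complexConj L) 3).Local v), c.IsConstituentOf P.toRepresentation →
      (IrrClass.comap (localPiEquiv L (IsCMField.complexConj L) 3 ((StdForm.antidiagonal 3).over L) v) c).IsConstituentOf
        (P'.finRep.smoothPart.toRepresentation.comp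
          (inclPlace (↥(maximalRealSubfield L)) L (IsCMField.complexConj L) 3 ((StdForm.antidiagonal 3).over L) v)))
    -- (D2) the sub with irreducible quotient and the intertwining maps killing it
    (K : Subrepresentation (cmPrincipalSeries L 3 v (cmXiTorusChar L v (μω.semilocalComponent L v)
      (torusLocalComponent L (IsCMField.complexConj L) v ξ.η) (torusLocalComponent L (IsCMField.complexConj L) v ξ.ψ))))
    (hK : K.quotientRep.IsIrreducible) {ι : Type*}
    (Φ : ι → (cmPrincipalSeries L 3 v (cmXiTorusChar L v (μω.semilocalComponent L v)
      (torusLocalComponent L (IsCMField.complexConj L) v ξ.η) (torusLocalComponent L (IsCMField.complexConj L) v ξ.ψ))).IntertwiningMap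
        (ρv.comp (cmDatumLocalCongr L v T ha h : Gqs L v →* (cmDatum L 3 ((StdForm.antidiagonal 3).over L)).Local v)))
    (hker : ∀ i, K ≤ (Φ i).ker)
    -- (D3) `P` meets the span of the images
    (hmeet : ∃ x ∈ P, x ≠ 0 ∧ x ∈ ⨆ i, LinearMap.range (Φ i).toLinearMap) :
    ∃ c : IrrClass ((quasiSplit (↥(maximalRealSubfield L)) L (IsCMField.complexConj L) 3).Local v),
      (IrrClass.comap (localPiEquiv L (IsCMField.complexConj L) 3 ((StdForm.antidiagonal 3).over L) v) c).IsConstituentOf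
          (P'.finRep.smoothPart.toRepresentation.comp
            (inclPlace (↥(maximalRealSubfield L)) L (IsCMField.complexConj L) 3 ((StdForm.antidiagonal 3).over L) v)) ∧
        ∃ (r : SmoothIrrep (Gqs L v))
          (N : Subrepresentation (cmPrincipalSeries L 3 v (cmXiTorusChar L v (μω.semilocalComponent L v)
            (torusLocalComponent L (IsCMField.complexConj L) v ξ.η) (torusLocalComponent L (IsCMField.complexConj L) v ξ.ψ)))),
          IrrClass.comap (cmDatumLocalCongr L v T ha h) c = IrrClass.mk r ∧
          Nonempty (r.ρ.Equiv ((cmPrincipalSeries L 3 v (cmXiTorusChar L v (μω.semilocalComponent L v)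
            (torusLocalComponent L (IsCMField.complexConj L) v ξ.η) (torusLocalComponent L (IsCMField.complexConj L) v ξ.ψ))).quotient N.toSubmodule
              fun g _ hx => N.apply_mem_toSubmodule g hx)) := by
  obtain ⟨c, hc, r, hcr, er⟩ := exists_isConstituentOf_comap_eq_mk_equiv_quotientRep (cmDatumLocalCongr L v T ha h) hρv P K hK Φ hker hmeet
  exact ⟨c, hD1 c hc, r, K, hcr, er⟩

end CM

end Summit.HodgeConjecture.HodgeConjecture.R90.S8

end
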